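import Summits.PneNP.PneNP.Theses.NoTardosTropics
import Literature.Computability.Complexity.OracleQueryMap

/-!
# `GlueNoTardos` (route NoTardosTropics, item stmt-PneNP-2571): `NoTropicalTardos → XAdd`

Glue #3 → #0 of the route `Summits/PneNP/PneNP/Theses/NoTardosTropics.lean`. Contrapositive: a
poly-time ORACLE-FREE sign-query algorithm `M` deciding `MPG_ℝ` (the object `XAdd` denies) is
turned into a poly-time sign-query algorithm deciding `MPG_ℝ` relative to the tagged oracle of
`NoTropicalTardos` (`true :: q ↦ [q ∈ MPG_ℤ]`, `false :: q ↦` sign of the coded form at `x`) that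
simply never sets the tag bit: every query `q` of `M` is re-asked as `false :: q`
(`OracleAlg.mapQuery` of `Literature/Computability/Complexity/OracleQueryMap.lean` with the
`FP` map `⟨x, ⟨listBool as, q⟩⟩ ↦ false :: q`). The tagged oracle answers `false :: q` exactly as
the sign oracle answers `q` (`MapAgree` holds by `rfl` after `boolUnpair_boolPair`), so the runs
coincide (`OracleAlg.run_mapQuery`), and polynomial time is preserved
(`OracleAlg.isPolyTime_mapQuery`, the map being `cons false ∘ snd ∘ snd ∈ FP`).
-/

set_option linter.dupNamespace false -- `Summit.PneNP.PneNP.…`: summit = sub-problem name (D-0017 single-conjunct layout)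

namespace Summit.PneNP.PneNP.Theorems

open Literature.Computability.Complexity Computability

/-- **Glue #3 → #0** (`GlueNoTardos`, item stmt-PneNP-2571): `NoTropicalTardos → XAdd`.
An oracle-free poly-time sign-query algorithm for `MPG_ℝ` is an oracle algorithm for the tagged
oracle `cond (headD qry false) [tail qry ∈ MPG_ℤ] (sign x (tail qry))` that prefixes every query
with `false` (`OracleAlg.mapQuery` with `cons false ∘ (boolUnpair ∘ snd ∘ boolUnpair).snd ∈ FP`);
its run is the original run (`run_mapQuery`, the agreement being definitional) and its step
function stays polynomial-time (`isPolyTime_mapQuery`). [folklore; route glue] -/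
theorem glueNoTardos_proof : Summit.PneNP.PneNP.Theses.NoTardosTropics.GlueNoTardos := by
  unfold Summit.PneNP.PneNP.Theses.NoTardosTropics.GlueNoTardos
    Summit.PneNP.PneNP.Theses.NoTardosTropics.NoTropicalTardos
    Summit.PneNP.PneNP.Theses.NoTardosTropics.XAdd
  intro hNT hX
  apply hNT
  obtain ⟨M, hM, q, hrun⟩ := hX
  refine ⟨M.mapQuery (List.cons false ∘ fun z : List Bool => (boolUnpair (boolUnpair z).2).2),
    OracleAlg.isPolyTime_mapQuery encodingBoolBool hM
      (comp_mem_FP (cons_mem_FP false) (comp_mem_FP boolUnpairSnd_mem_FP boolUnpairSnd_mem_FP)),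
    q, fun n x => ?_⟩
  refine (OracleAlg.run_mapQuery M _ _ _ _ ?_ _).trans (hrun n x)
  intro i q' _ _
  simp only [Function.comp_apply, boolUnpair_boolPair]
  rfl

end Summit.PneNP.PneNP.Theorems
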